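import Summits.Parity.GeneralizedHardyLittlewood.Theorems.Dhl42DensityFormula
import Summits.Parity.GeneralizedHardyLittlewood.Theorems.Dhl42ClosedFormSetup

/-!
# DHL[42,2] certificate — `I(F₀)` in closed form, part 1: soundness of the §7.2 data, symmetry classes

(i) The `ExpPoly` data of `Dhl42ClosedFormSetup` denote the §7 functions: `⟦GE⟧ = g²`, `⟦GHE⟧ = gh`,
`⟦H2E⟧ = h²`, `⟦phiS⟧ = Φ_S`, `⟦phiK⟧ = Φ_K`, `⟦chiK⟧ = χ_K`, and `Φ`, `χ` are these polynomials on
`s ≤ K` / `s > K`; (ii) factor selectors `Esel`, Kronecker deltas, factor families `fam m` and **the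
algebra of the square** `sq_expand`: `(Π g(t_j))² (a + b Σ_l η(t_l))²` (`η = h/g`) expands into the
classes all-`G` / one `gh` / one `h²` / two `gh`; (iii) canonical representatives `gB`, `gC`, `gD`
and the reduction of every class member to its representative by a permutation of coordinates
(`classB/C/D_eq`), whence **`integral_classes`**:
`∫_Δ (Π g)² (a + bΣη)² = V₀ + 2(n+3)V₁ + (n+3)V₂ + (n+3)(n+2)V₃` in any dimension `n + 3`. Continued
in `Dhl42MainIPairs` (the `k = 42` evaluation).

Origin: `Dhl42/ClosedForm/MainI.lean` of the DHL[42,2] certificate package (pub-dhl42 bundle,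
archive blob `18cce9e3`; sha256[:16] of the file `1ed72deade926703`; paper snapshot =
`paper/main.tex` v1), lines :26–:341; statements and proofs unchanged except: namespace
`Dhl42.ClosedForm` → `Summit.Parity.GeneralizedHardyLittlewood.Theorems.Dhl42.ClosedForm`,
`open TpY4Dhl42` dropped (the certificate's Part 1–7 declarations, migrated to
`Summit.Parity.GeneralizedHardyLittlewood.Theorems.Dhl42` in batches B2/B3, are in scope in the
sub-namespace), `Dhl42.ExpPoly` → the tree's `Literature.Analysis.ValidatedNumerics.ExpPoly`
(`ExpPoly/*.lean`, batch B1), the package's `simplexSet n B` replaced by the tree's definitionally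
equal `Literature.NumberTheory.Sieve.scaledSimplex n B` (also inside the names of the B2/B3 lemmas
used), docstrings added where missing. Package-internal references in the verbatim docstrings
(`Density.lean`, `Setup.lean`, `KernelBridge.lean`, `MainI.…`) refer to that package (paper Appendix
B).

Declarations (39): `exp_rate`, `gfun_eq`, `hfun_eq`, `GE_eval`, `GHE_eval`, `H2E_eval`, `gE_eval`,
`hE_eval`, `Sq_cast`, `Kq_cast`, `phiS_eval`, `phiK_eval`, `chiK_eval`, `Phi_of_le`, `Phi_of_gt`,
`chi_of_le`, `chi_of_gt`, `Esel`, `Esel_eval`, `dlt`, `dlt_le`, `prod_pow_dlt`, `fam`, `prod_fam`,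
`fam_zero`, `sq_expand`, `fam_comp`, `dlt_perm`, `sum_sum_ite_eq`, `gB`, `gC`, `gD`, `gB_eq`,
`gC_eq`, `gD_eq`, `classB_eq`, `classC_eq`, `classD_eq`, `integral_classes`.
-/

open MeasureTheory Set Filter Real intervalIntegral
open Literature.Analysis.ValidatedNumerics.ExpPoly
open Literature.NumberTheory.Sieve (scaledSimplex)

namespace Summit.Parity.GeneralizedHardyLittlewood.Theorems.Dhl42.ClosedForm

noncomputable section

/-! ### The one-variable data as functions of `y = e^{-20t}` -/

/-- `e^{ct} = (e^{−20t})^m` when `c = −20m`: every rate of the Section 7.2 profiles is a multiple of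
`−20`. -/
theorem exp_rate (c : ℚ) (m : ℕ) (hc : (c : ℝ) = -(20 * (m : ℝ))) (t : ℝ) :
    exp ((c : ℝ) * t) = exp (-(20 * t)) ^ m := by
  rw [hc, ← Real.exp_nat_mul]; ring_nf

/-- `g(t) = 1 + 3y + 6y⁴ + 8y¹⁵` with `y = e^{−20t}` (Section 7.2). -/
theorem gfun_eq (t : ℝ) :
    gfun t = 1 + 3 * exp (-(20 * t)) + 6 * exp (-(20 * t)) ^ 4 + 8 * exp (-(20 * t)) ^ 15 := by
  unfold gfun
  rw [show -(80 * t) = (4 : ℕ) * (-(20 * t)) by push_cast; ring, Real.exp_nat_mul,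
    show -(300 * t) = (15 : ℕ) * (-(20 * t)) by push_cast; ring, Real.exp_nat_mul]

/-- `h(t) = 1 − y⁵` with `y = e^{−20t}` (Section 7.2). -/
theorem hfun_eq (t : ℝ) : hfun t = 1 - exp (-(20 * t)) ^ 5 := by
  unfold hfun
  rw [show -(100 * t) = (5 : ℕ) * (-(20 * t)) by push_cast; ring, Real.exp_nat_mul]

/-- Soundness of the data `GE`: `⟦GE⟧(t) = g(t)²`. -/
theorem GE_eval (t : ℝ) : ES.eval GE t = gfun t ^ 2 := by
  rw [gfun_eq]
  simp only [GE, ES.eval_cons, ES.eval_nil]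
  rw [exp_rate 0 0 (by norm_num) t, exp_rate (-20) 1 (by norm_num) t, exp_rate (-40) 2 (by norm_num) t,
    exp_rate (-80) 4 (by norm_num) t, exp_rate (-100) 5 (by norm_num) t,
    exp_rate (-160) 8 (by norm_num) t, exp_rate (-300) 15 (by norm_num) t,
    exp_rate (-320) 16 (by norm_num) t, exp_rate (-380) 19 (by norm_num) t,
    exp_rate (-600) 30 (by norm_num) t]
  push_cast; ring

/-- Soundness of the data `GHE`: `⟦GHE⟧(t) = g(t) h(t)`. -/
theorem GHE_eval (t : ℝ) : ES.eval GHE t = gfun t * hfun t := by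
  rw [gfun_eq, hfun_eq]
  simp only [GHE, ES.eval_cons, ES.eval_nil]
  rw [exp_rate 0 0 (by norm_num) t, exp_rate (-20) 1 (by norm_num) t, exp_rate (-80) 4 (by norm_num) t,
    exp_rate (-300) 15 (by norm_num) t, exp_rate (-100) 5 (by norm_num) t,
    exp_rate (-120) 6 (by norm_num) t, exp_rate (-180) 9 (by norm_num) t,
    exp_rate (-400) 20 (by norm_num) t]
  push_cast; ring

/-- Soundness of the data `H2E`: `⟦H2E⟧(t) = h(t)²`. -/
theorem H2E_eval (t : ℝ) : ES.eval H2E t = hfun t ^ 2 := by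
  rw [hfun_eq]
  simp only [H2E, ES.eval_cons, ES.eval_nil]
  rw [exp_rate 0 0 (by norm_num) t, exp_rate (-100) 5 (by norm_num) t, exp_rate (-200) 10 (by norm_num) t]
  push_cast; ring

/-- Soundness of the data `gE`: `⟦gE⟧(t) = g(t)`. -/
theorem gE_eval (t : ℝ) : ES.eval gE t = gfun t := by
  rw [gfun_eq]
  simp only [gE, ES.eval_cons, ES.eval_nil]
  rw [exp_rate 0 0 (by norm_num) t, exp_rate (-20) 1 (by norm_num) t, exp_rate (-80) 4 (by norm_num) t,
    exp_rate (-300) 15 (by norm_num) t]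
  push_cast; ring

/-- Soundness of the data `hE`: `⟦hE⟧(t) = h(t)`. -/
theorem hE_eval (t : ℝ) : ES.eval hE t = hfun t := by
  rw [hfun_eq]
  simp only [hE, ES.eval_cons, ES.eval_nil]
  rw [exp_rate 0 0 (by norm_num) t, exp_rate (-100) 5 (by norm_num) t]
  push_cast; ring

/-! ### The radial polynomials -/

/-- The rational `Sq = 209/200` is the real parameter `S` (`Sc`). -/
theorem Sq_cast : ((Sq : ℚ) : ℝ) = Sc := by norm_num [Sq, Sc, eps]
/-- The rational `Kq = 191/200` is the real parameter `K` (`Kc`). -/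
theorem Kq_cast : ((Kq : ℚ) : ℝ) = Kc := by norm_num [Kq, Kc, eps]

/-- Soundness of `phiS`: `⟦phiS⟧(s) = Φ_S(s)` (`PhiPoly`). -/
theorem phiS_eval (s : ℝ) : Poly.eval phiS s = PhiPoly s := by
  simp only [phiS, cvecQ, Poly.eval_shift_cons, Poly.eval_shift_nil, PhiPoly, cvec, Sq_cast,
    Fin.sum_univ_succ, Fin.sum_univ_zero, Matrix.cons_val_zero, Matrix.cons_val_succ,
    Fin.val_zero, Fin.val_succ]
  push_cast; ring

/-- Soundness of `phiK`: `⟦phiK⟧(s) = Φ_K(s)` (`PhiCut`, the polynomial part; the cut-off at `K` is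
applied by `Phi`). -/
theorem phiK_eval (s : ℝ) : Poly.eval phiK s = PhiCut s := by
  simp only [phiK, cpvecQ, Poly.eval_shift_cons, Poly.eval_shift_nil, PhiCut, cpvec, Kq_cast,
    Fin.sum_univ_succ, Fin.sum_univ_zero, Matrix.cons_val_zero, Matrix.cons_val_succ,
    Fin.val_zero, Fin.val_succ]
  push_cast; ring

/-- Soundness of `chiK`: `⟦chiK⟧(s) = χ_K(s)` (`chiPoly`, the polynomial part). -/
theorem chiK_eval (s : ℝ) : Poly.eval chiK s = chiPoly s := by
  simp only [chiK, dvecQ, Poly.eval_shift_cons, Poly.eval_shift_nil, chiPoly, dvec, Kq_cast,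
    Fin.sum_univ_succ, Fin.sum_univ_zero, Matrix.cons_val_zero, Matrix.cons_val_succ,
    Fin.val_zero, Fin.val_succ]
  push_cast; ring

/-- On `s ≤ K`: `Φ(s) = Φ_S(s) + Φ_K(s) = ⟦phiLo⟧(s)`. -/
theorem Phi_of_le {s : ℝ} (hs : s ≤ Kc) : Phi s = Poly.eval phiLo s := by
  rw [Phi_eq, if_pos hs, phiLo, Poly.eval_add, phiS_eval, phiK_eval]

/-- On `s > K`: `Φ(s) = Φ_S(s) = ⟦phiS⟧(s)`. -/
theorem Phi_of_gt {s : ℝ} (hs : Kc < s) : Phi s = Poly.eval phiS s := by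
  rw [Phi_eq, if_neg (not_le.2 hs), phiS_eval, add_zero]

/-- On `s ≤ K`: `χ(s) = χ_K(s) = ⟦chiK⟧(s)`. -/
theorem chi_of_le {s : ℝ} (hs : s ≤ Kc) : chi s = Poly.eval chiK s := by
  rw [chi_eq, if_pos hs, chiK_eval]

/-- On `s > K`: `χ(s) = 0`. -/
theorem chi_of_gt {s : ℝ} (hs : Kc < s) : chi s = 0 := by
  rw [chi_eq, if_neg (not_le.2 hs)]

/-! ### Factor selectors and the symmetry classes (any number of coordinates) -/

/-- `Esel m` = the one-variable factor carrying `η^m`: `G`, `gh`, `h²`. -/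
def Esel : ℕ → ES
  | 0 => GE
  | 1 => GHE
  | _ => H2E

/-- `G(x) η(x)^m = Esel m (x)` for `m ≤ 2`, `η = h/g`. -/
theorem Esel_eval {m : ℕ} (hm : m ≤ 2) (x : ℝ) :
    ES.eval (Esel m) x = gfun x ^ 2 * (hfun x / gfun x) ^ m := by
  have hg : gfun x ≠ 0 := (gfun_pos x).ne'
  interval_cases m
  · simp [Esel, GE_eval]
  · rw [show Esel 1 = GHE from rfl, GHE_eval]; field_simp
  · rw [show Esel 2 = H2E from rfl, H2E_eval]; field_simp

section Generic

variable {k : ℕ}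

/-- Kronecker delta. -/
def dlt (j l : Fin k) : ℕ := if j = l then 1 else 0

/-- `δ_{jl} ≤ 1`. -/
theorem dlt_le (j l : Fin k) : dlt j l ≤ 1 := by unfold dlt; split_ifs <;> omega

/-- `Π_j a_j^{δ_{jl}} = a_l`. -/
theorem prod_pow_dlt (a : Fin k → ℝ) (l : Fin k) : ∏ j, a j ^ dlt j l = a l := by
  rw [Finset.prod_eq_single l]
  · simp [dlt]
  · intro j _ hj; simp [dlt, hj]
  · simp

/-- The factor family of the class indexed by multiplicities `m`. -/
def fam (m : Fin k → ℕ) : Fin k → ES := fun j => Esel (m j)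

/-- The product of the factor family of multiplicities `m` (`m_j ≤ 2`):
`Π_j ⟦fam m j⟧(t_j) = (Π_j g(t_j)²) · Π_j η(t_j)^{m_j}`, `η = h/g`. -/
theorem prod_fam (m : Fin k → ℕ) (hm : ∀ j, m j ≤ 2) (t : Fin k → ℝ) :
    ∏ j, ES.eval (fam m j) (t j) = (∏ j, gfun (t j) ^ 2) * ∏ j, (hfun (t j) / gfun (t j)) ^ m j := by
  rw [← Finset.prod_mul_distrib]
  exact Finset.prod_congr rfl fun j _ => Esel_eval (hm j) (t j)

/-- Multiplicities `0`: the family of `k` factors `G`. -/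
theorem fam_zero : fam (fun _ : Fin k => 0) = fun _ => GE := rfl

/-- **The algebra of the square**: `(Π g(t_j))² (a + b Σ_l η(t_l))²` expanded into the classes. -/
theorem sq_expand (t : Fin k → ℝ) (a b : ℝ) :
    ((∏ j, gfun (t j)) * (a + b * ∑ l, hfun (t l) / gfun (t l))) ^ 2 =
      (∏ j, ES.eval (fam (fun _ : Fin k => 0) j) (t j)) * a ^ 2 +
      2 * ∑ l, (∏ j, ES.eval (fam (fun j => dlt j l) j) (t j)) * (a * b) +
      ∑ l, ∑ l', (∏ j, ES.eval (fam (fun j => dlt j l + dlt j l') j) (t j)) * b ^ 2 := by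
  have hA : ∏ j, ES.eval (fam (fun _ : Fin k => 0) j) (t j) = (∏ j, gfun (t j)) ^ 2 := by
    rw [prod_fam _ (fun _ => by omega), Finset.prod_pow]; simp
  have hB : ∀ l, ∏ j, ES.eval (fam (fun j => dlt j l) j) (t j) =
      (∏ j, gfun (t j)) ^ 2 * (hfun (t l) / gfun (t l)) := by
    intro l
    rw [prod_fam _ (fun j => by have := dlt_le j l; omega), Finset.prod_pow, prod_pow_dlt]
  have hC : ∀ l l', ∏ j, ES.eval (fam (fun j => dlt j l + dlt j l') j) (t j) =
      (∏ j, gfun (t j)) ^ 2 * ((hfun (t l) / gfun (t l)) * (hfun (t l') / gfun (t l'))) := by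
    intro l l'
    rw [prod_fam _ (fun j => by have := dlt_le j l; have := dlt_le j l'; omega), Finset.prod_pow]
    congr 1
    simp_rw [pow_add]
    rw [Finset.prod_mul_distrib, prod_pow_dlt, prod_pow_dlt]
  simp only [hA, hB, hC]
  simp only [← Finset.sum_mul, ← Finset.mul_sum]
  ring

/-- Composing a class family with a permutation permutes the multiplicities. -/
theorem fam_comp (m : Fin k → ℕ) (τ : Equiv.Perm (Fin k)) : fam m ∘ ⇑τ = fam (m ∘ ⇑τ) := rfl

/-- Kronecker deltas transported along a permutation `τ` with `τ l = a`: `δ_{τ j, a} = δ_{j l}`. -/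
theorem dlt_perm (τ : Equiv.Perm (Fin k)) {l a : Fin k} (h : τ l = a) (j : Fin k) :
    dlt (τ j) a = dlt j l := by
  unfold dlt
  have : τ j = a ↔ j = l := by
    constructor
    · intro hj; exact τ.injective (hj.trans h.symm)
    · rintro rfl; exact h
  simp only [this]

/-- Counting the diagonal and off-diagonal pairs. -/
theorem sum_sum_ite_eq (a b : ℝ) :
    ∑ l : Fin k, ∑ l' : Fin k, (if l = l' then a else b) = k * a + (k * (k - 1) : ℝ) * b := by
  have : ∀ l : Fin k, ∑ l' : Fin k, (if l = l' then a else b) = a + ((k : ℝ) - 1) * b := by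
    intro l
    rw [Finset.sum_ite, Finset.sum_const, Finset.sum_const]
    have h1 : (Finset.univ.filter fun l' : Fin k => l = l').card = 1 := by
      rw [Finset.card_eq_one]; exact ⟨l, by ext x; simp [eq_comm]⟩
    have h2 : ((Finset.univ.filter fun l' : Fin k => ¬ l = l').card : ℝ) = k - 1 := by
      have := Finset.card_filter_add_card_filter_not (s := Finset.univ) (fun l' : Fin k => l = l')
      rw [h1, Finset.card_univ, Fintype.card_fin] at this
      have hk : 1 ≤ k := by omega
      rw [show (Finset.univ.filter fun l' : Fin k => ¬ l = l').card = k - 1 by omega]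
      push_cast [Nat.cast_sub hk]; ring
    rw [h1, nsmul_eq_mul, nsmul_eq_mul, h2]; simp
  simp only [this, Finset.sum_const, Finset.card_univ, Fintype.card_fin, nsmul_eq_mul]
  ring

end Generic

/-! ### Canonical representatives and the reduction by permutations -/

section Canonical

variable {n : ℕ}

/-- Canonical representatives: the special factors in front. -/
def gB (n : ℕ) : Fin (n + 2) → ES := Fin.cons GHE fun _ => GE
/-- Canonical representative of class C (one factor `h²` in front, then `G`'s). -/
def gC (n : ℕ) : Fin (n + 2) → ES := Fin.cons H2E fun _ => GE
/-- Canonical representative of class D (two factors `gh` in front, then `G`'s). -/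
def gD (n : ℕ) : Fin (n + 3) → ES := Fin.cons GHE (Fin.cons GHE fun _ => GE)

/-- `gB` is the factor family of multiplicities `δ_{j0}`. -/
theorem gB_eq (n : ℕ) : gB n = fam fun j => dlt j 0 := by
  funext j; refine Fin.cases ?_ (fun i => ?_) j
  · simp [gB, fam, dlt, Esel]
  · simp [gB, fam, dlt, Esel, Fin.succ_ne_zero]

/-- `gC` is the factor family of multiplicities `2δ_{j0}`. -/
theorem gC_eq (n : ℕ) : gC n = fam fun j => dlt j 0 + dlt j 0 := by
  funext j; refine Fin.cases ?_ (fun i => ?_) j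
  · simp [gC, fam, dlt, Esel]
  · simp [gC, fam, dlt, Esel, Fin.succ_ne_zero]

/-- `gD` is the factor family of multiplicities `δ_{j0} + δ_{j1}`. -/
theorem gD_eq (n : ℕ) : gD n = fam fun j => dlt j 0 + dlt j 1 := by
  funext j; refine Fin.cases ?_ (fun i => ?_) j
  · simp [gD, fam, dlt, Esel]
  · refine Fin.cases ?_ (fun i' => ?_) i
    · simp [gD, fam, dlt, Esel]
    · have h1 : (i'.succ.succ : Fin (n + 3)) ≠ 1 := by
        intro h
        have := congrArg Fin.val h
        simp at this
      simp [gD, fam, dlt, Esel, Fin.succ_ne_zero, h1]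

/-- One marked factor at place `l`: same integral as the canonical representative. -/
theorem classB_eq (l : Fin (n + 2)) (B : ℝ) (φ : ℝ → ℝ) :
    ∫ t, simplexIntegrand (n + 1) (fam fun j => dlt j l) B φ t =
      ∫ t, simplexIntegrand (n + 1) (gB n) B φ t := by
  have hτ : (Equiv.swap (0 : Fin (n + 2)) l) l = 0 := Equiv.swap_apply_right _ _
  have hfam : fam (fun j => dlt j l) = gB n ∘ ⇑(Equiv.swap (0 : Fin (n + 2)) l) := by
    rw [gB_eq, fam_comp]
    congr 1; funext j; exact (dlt_perm _ hτ j).symm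
  rw [hfam, integral_simplexIntegrand_perm]

/-- One doubly marked factor at place `l` (`h²`): same simplex integral as the canonical
representative `gC` (permutation invariance). -/
theorem classC_eq (l : Fin (n + 2)) (B : ℝ) (φ : ℝ → ℝ) :
    ∫ t, simplexIntegrand (n + 1) (fam fun j => dlt j l + dlt j l) B φ t =
      ∫ t, simplexIntegrand (n + 1) (gC n) B φ t := by
  have hτ : (Equiv.swap (0 : Fin (n + 2)) l) l = 0 := Equiv.swap_apply_right _ _
  have hfam : fam (fun j => dlt j l + dlt j l) = gC n ∘ ⇑(Equiv.swap (0 : Fin (n + 2)) l) := by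
    rw [gC_eq, fam_comp]
    congr 1; funext j; simp only [Function.comp_apply, dlt_perm _ hτ j]
  rw [hfam, integral_simplexIntegrand_perm]

/-- Two singly marked factors at places `l ≠ l'` (`gh`, `gh`): same simplex integral as the
canonical representative `gD`. -/
theorem classD_eq {l l' : Fin (n + 3)} (hll' : l ≠ l') (B : ℝ) (φ : ℝ → ℝ) :
    ∫ t, simplexIntegrand (n + 2) (fam fun j => dlt j l + dlt j l') B φ t =
      ∫ t, simplexIntegrand (n + 2) (gD n) B φ t := by
  -- a permutation with τ l = 0, τ l' = 1
  set m : Fin (n + 3) := Equiv.swap (0 : Fin (n + 3)) l l' with hm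
  have hm0 : m ≠ 0 := by
    intro h
    rw [hm, Equiv.swap_apply_eq_iff, Equiv.swap_apply_left] at h
    exact hll' h.symm
  set τ : Equiv.Perm (Fin (n + 3)) :=
    (Equiv.swap (0 : Fin (n + 3)) l).trans (Equiv.swap (1 : Fin (n + 3)) m) with hτ
  have hτl : τ l = 0 := by
    rw [hτ, Equiv.trans_apply, Equiv.swap_apply_right]
    exact Equiv.swap_apply_of_ne_of_ne (by simp) hm0.symm
  have hτl' : τ l' = 1 := by
    rw [hτ, Equiv.trans_apply, ← hm, Equiv.swap_apply_right]
  have hfam : fam (fun j => dlt j l + dlt j l') = gD n ∘ ⇑τ := by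
    rw [gD_eq, fam_comp]
    congr 1; funext j; simp only [Function.comp_apply, dlt_perm _ hτl j, dlt_perm _ hτl' j]
  rw [hfam, integral_simplexIntegrand_perm]

/-- **Class decomposition of a squared-marked integral**: for any bounded measurable `a, b` of the
coordinate sum, `∫_Δ (Π g)² (a + b Σ η)²` is `V₀ + 2(n+3)V₁ + (n+3)V₂ + (n+3)(n+2)V₃` in terms of the
canonical class integrals. -/
theorem integral_classes (B : ℝ) {a b : ℝ → ℝ} (hA : TestFn B fun v => a v ^ 2)
    (hB : TestFn B fun v => a v * b v) (hC : TestFn B fun v => b v ^ 2) :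
    ∫ t, (scaledSimplex (n + 3) B).indicator
        (fun t => ((∏ j, gfun (t j)) * (a (∑ j, t j) + b (∑ j, t j) * ∑ l, hfun (t l) / gfun (t l))) ^ 2) t =
      (∫ t, simplexIntegrand (n + 2) (fun _ => GE) B (fun v => a v ^ 2) t) +
      2 * (n + 3) * (∫ t, simplexIntegrand (n + 2) (gB (n + 1)) B (fun v => a v * b v) t) +
      (n + 3) * (∫ t, simplexIntegrand (n + 2) (gC (n + 1)) B (fun v => b v ^ 2) t) +
      (n + 3) * (n + 2) * (∫ t, simplexIntegrand (n + 2) (gD n) B (fun v => b v ^ 2) t) := by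
  -- pointwise expansion
  have hpt : ∀ t : Fin (n + 3) → ℝ, (scaledSimplex (n + 3) B).indicator
      (fun t => ((∏ j, gfun (t j)) * (a (∑ j, t j) + b (∑ j, t j) * ∑ l, hfun (t l) / gfun (t l))) ^ 2) t =
      simplexIntegrand (n + 2) (fam fun _ => 0) B (fun v => a v ^ 2) t +
      2 * ∑ l, simplexIntegrand (n + 2) (fam fun j => dlt j l) B (fun v => a v * b v) t +
      ∑ l, ∑ l', simplexIntegrand (n + 2) (fam fun j => dlt j l + dlt j l') B (fun v => b v ^ 2) t := by
    intro t
    by_cases ht : t ∈ scaledSimplex (n + 3) B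
    · have hind : ∀ (f : Fin (n + 3) → ES) (φ : ℝ → ℝ), simplexIntegrand (n + 2) f B φ t =
          (∏ j, ES.eval (f j) (t j)) * φ (∑ j, t j) := fun f φ => indicator_of_mem ht _
      simp only [hind, indicator_of_mem ht, sq_expand]
    · have hind : ∀ (f : Fin (n + 3) → ES) (φ : ℝ → ℝ), simplexIntegrand (n + 2) f B φ t = 0 :=
        fun f φ => indicator_of_notMem ht _
      simp only [hind, indicator_of_notMem ht]; simp
  have hiA := integrable_simplexIntegrand (n + 2) (fam fun _ => 0) B hA
  have hiB : ∀ l, Integrable (simplexIntegrand (n + 2) (fam fun j => dlt j l) B fun v => a v * b v) :=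
    fun l => integrable_simplexIntegrand _ _ B hB
  have hiC : ∀ l l', Integrable (simplexIntegrand (n + 2) (fam fun j => dlt j l + dlt j l') B fun v => b v ^ 2) :=
    fun l l' => integrable_simplexIntegrand _ _ B hC
  simp_rw [hpt]
  have hiS : Integrable (fun t => 2 * ∑ l, simplexIntegrand (n + 2) (fam fun j => dlt j l) B (fun v => a v * b v) t) :=
    (integrable_finsetSum _ fun l _ => hiB l).const_mul 2
  have hiD : Integrable (fun t => ∑ l, ∑ l',
      simplexIntegrand (n + 2) (fam fun j => dlt j l + dlt j l') B (fun v => b v ^ 2) t) :=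
    integrable_finsetSum _ fun l _ => integrable_finsetSum _ fun l' _ => hiC l l'
  rw [integral_add (f := fun t => simplexIntegrand (n + 2) (fam fun _ => 0) B (fun v => a v ^ 2) t +
      2 * ∑ l, simplexIntegrand (n + 2) (fam fun j => dlt j l) B (fun v => a v * b v) t) (hiA.add hiS) hiD,
    integral_add (f := simplexIntegrand (n + 2) (fam fun _ => 0) B fun v => a v ^ 2) hiA hiS,
    MeasureTheory.integral_const_mul, integral_finsetSum _ (fun l _ => hiB l),
    integral_finsetSum _ (fun l _ => integrable_finsetSum _ fun l' _ => hiC l l')]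
  simp_rw [integral_finsetSum _ (fun l' _ => hiC _ l')]
  simp_rw [classB_eq]
  have hCD : ∀ l l' : Fin (n + 3),
      ∫ t, simplexIntegrand (n + 2) (fam fun j => dlt j l + dlt j l') B (fun v => b v ^ 2) t =
      if l = l' then ∫ t, simplexIntegrand (n + 2) (gC (n + 1)) B (fun v => b v ^ 2) t
      else ∫ t, simplexIntegrand (n + 2) (gD n) B (fun v => b v ^ 2) t := by
    intro l l'
    split_ifs with h
    · subst h; exact classC_eq l B _
    · exact classD_eq h B _
  simp_rw [hCD]
  rw [sum_sum_ite_eq, fam_zero]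
  simp only [Finset.sum_const, Finset.card_univ, Fintype.card_fin, nsmul_eq_mul]
  push_cast
  ring

end Canonical

end

end Summit.Parity.GeneralizedHardyLittlewood.Theorems.Dhl42.ClosedForm
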